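import Literature.NumberTheory.ComplexMultiplication.CMTypeRankAlternatingBlock
import Literature.NumberTheory.ComplexMultiplication.ReflexDegreeMaximal
import Literature.NumberTheory.ComplexMultiplication.QuarticCMTypes
import Mathlib.GroupTheory.GroupAction.SubMulAction.Combination
import HarnessLib

/-!
# CM fields whose maximal real subfield has Galois group `Aₙ` or `Sₙ`, `n` odd: the pair kernel is `{1, ρ}` or
# `(ℤ₂)ⁿ`, and every primitive CM type is nondegenerate — Dodson 1987, Proposition 2.1

B. Dodson, *On the Mumford–Tate group of an abelian variety with complex multiplication*, J. Algebra **111**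
(1987) 49–73 [Dodson1987] (held text `paper:doi-10-1016-0021-8693-87-90242-0`, p. 58 L38 – p. 59 L8):

> "PROPOSITION 2.1. Let `n` be odd and suppose that `K` is a CM-field of degree `2n` such that the maximal
> totally real subfield `K₀` has `Gal(K₀ᶜ/ℚ) ≅ Aₙ`, or `Sₙ`. Then every primitive CM-type `(K, Φ)` is nondegenerate.
> *Proof.* By [9, Proposition 2.2.2] we have that either there is a single `Gal(Kᶜ/ℚ)`-orbit of types of order
> `2ⁿ`, in which case `Rank(Φ) = n + 1` is clear, or else `K` contains an imaginary quadratic subfield. In the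
> latter case … in the action on types `e = 0` or `ρ` … there are only `(n − 1)/2` orbits of primitive types …
> we conclude that `Rank(Φ) = n + 1` by the Constant Weight Criterion [8]."

This file proves the Proposition as printed (`isNondegenerate_of_isPrimitive_of_factorial_dvd_finrank_normalClosure_of_odd`,
the hypothesis "`Gal(K₀ᶜ/ℚ) ≅ Aₙ, or Sₙ`" on the image of `Gal(K₀ᶜ/ℚ) ↪ Sₙ` being stated as `n!/2 ∣ [K₀ᶜ : ℚ]`,
`K₀ᶜ = normalClosure ℚ K⁺ L` inside a normal closure `L` of `K`), on top of the companion file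
`CMTypeRankAlternatingBlock` (the "latter case": the exact rank over an imaginary quadratic subfield) and of
`ReflexDegreeMaximal` (`v = n` ⟹ every type nondegenerate, Ribet's Cor. (3.6) [Ribet1980]).

## Part I — group level (`G ↷ E` faithfully, `ρ` central, `π : E → P` the pairs `{x, ρx}`)

* **Imprimitivity Theorem (2) made explicit** [Dodson1984, §1.1]: the set of pairs FLIPPED by an element of the
  pair kernel `(ℤ₂)ᵛ` (the `Finset` of `p` with `g y = ρ y` on the fibre of `p`) is a homomorphism to
  `(𝒫(P), ∆)` (`filter_flip_mul`), `G`-equivariant (`filter_flip_conj`), injective (`eq_of_filter_flip_eq`), with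
  `ρ ↦ P` and `1 ↦ ∅`; the kernel of `G → Sym(P)` is the pair kernel (`toPerm_pairSpace_eq_one_iff`).
* **The dichotomy `v = 1` or `v = n`** (`pairKernel_subset_or_card_eq_two_pow`): if the image `Ḡ` of `G` in
  `Sym(P)` contains `Alt(P)` and `n = |P| ≥ 3` is ODD, the pair kernel is `{1, ρ}` or has `2ⁿ` elements.  Proof:
  `Ḡ ⊇ Aₙ` is `k`-homogeneous (Mathlib `Set.powersetCard.isPretransitive_alternatingGroup`), so one flip set
  `∅ ≠ S ≠ P` yields one of size `2` (`exists_filter_flip_card_eq_two`: `S ∆ (S − a + b) = {a, b}`), then all even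
  sets, and with `ρ` (odd `n`) all sets.  In the second case every CM type has rank `n + 1`
  (`typeRank_eq_of_not_pairKernel_subset`).  (Dodson cites [9] = Dodson, *Solvable and nonsolvable CM-fields*,
  Amer. J. Math. 108 (1986), Prop. 2.2.2 — not held, `acq-08227`; the argument here is the standard one on
  `Aₙ`-submodules of `(ℤ₂)ⁿ` containing `(1, …, 1)`.)
* **`v = 1` ⟹ an imaginary quadratic subfield** (`exists_monoidHom_stabilizer_le_ker`): for `n` odd there is a
  character `χ : G → {±1}` with `χ(ρ) = −1` trivial on `Stab(φ₀) = Gal(Kᶜ/K)` — so `k = (Kᶜ)^{ker χ} ⊆ K` is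
  imaginary quadratic.  DEVIATION from the printed road (which invokes [9, Prop. 2.2.2]): we take `χ = sign_E` or
  `χ = sign_E · sign_P`, using `sign_E(ρ) = (−1)ⁿ` (`sign_toPerm_rho`: `ρ` is a fixed-point-free involution) and
  the fact that on `Stab(φ₀) ≅ Ḡ_{p₀} ⊇ Alt(P)_{p₀}` the character `sign_E` is trivial on the lifts of `3`-cycles
  (they have order `3` since `Stab(φ₀) ∩ (ℤ₂)ᵛ = 1`), which generate `Alt(P)_{p₀}`
  (Mathlib `Equiv.Perm.closure_three_cycles_eq_alternating` on `P ∖ {p₀}`): `sign_toPerm_eq_one_of_sign_eq_one`.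
* **The block** (`isCMTypeWith_orbit_ker`, `smul_orbit_ker_eq_or`): `E₀ = (ker χ)φ₀` is a CM type permuted by `G`
  as `{E₀, ρE₀}` — "in the action on types `e = 0` or `ρ`" — of size `n`, and `n! ∣ |G| = 2|Ḡ|`
  (`factorial_card_pairSpace_dvd_card`), so `CMTypeRankAlternatingBlock` applies:
  **`typeRank_eq_of_isPrimitive_of_alternatingGroup_le_of_odd`** — Proposition 2.1 at group level.

## Part II — number fields

For a CM field `K` with normal closure `L` (`IsNormalClosure ℚ K L`), `G = Gal(L/ℚ)` acts on `E = Hom_ℚ(K, L)`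
with `ρ = conjGal`, and the pairs are the embeddings of the maximal totally real subfield: restriction
`Hom_ℚ(K, L) → Hom_ℚ(K⁺, L)` has fibres `{φ, φ̄}` (`restrict_maximalRealSubfield_eq_iff`, from
`forall_apply_eq_iff_smul_eq_or`), is onto (`restrict_maximalRealSubfield_surjective`) and equivariant; its
kernel is `Gal(L/K₀ᶜ)` (`ker_toPermHom_restrict_maximalRealSubfield_eq`) and its image has `[K₀ᶜ : ℚ]` elements
(`card_range_toPermHom_restrict_maximalRealSubfield`), so `n!/2 ∣ [K₀ᶜ : ℚ]` gives `Ḡ ⊇ Aₙ`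
(`alternatingGroup_le_range_toPermHom_of_factorial_dvd`, Mathlib `Equiv.Perm.alternatingGroup_le_of_index_le_two`).
**`isNondegenerate_of_isPrimitive_of_factorial_dvd_finrank_normalClosure_of_odd`** is Proposition 2.1; the printed
dichotomy on the field is `finrank_normalClosure_maximalRealSubfield_eq_two_or_eq_two_pow` (`[Kᶜ : K₀ᶜ] ∈ {2, 2ⁿ}`),
`exists_intermediateField_le_fieldRange_of_finrank_normalClosure_eq_two` (`[Kᶜ : K₀ᶜ] = 2` ⟹ an imaginary quadratic
`k ⊆ j(K)`, `k = (Kᶜ)^{ker χ}`) and `forall_isNondegenerate_or_exists_intermediateField_le_fieldRange` ("either …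
`Rank(Φ) = n + 1` [for every type] … or else `K` contains an imaginary quadratic subfield").

Everything here is proved (no named facts).

## References
* [Dodson1987] B. Dodson, J. Algebra 111 (1987) 49–73, §2.1.1 Prop. 2.1 (pp. 58–59).
* [Dodson1984] B. Dodson, *The structure of Galois groups of CM-fields*, Trans. AMS 283 (1984) 1–32, §1.1
  (Proposition; Imprimitivity Theorem (2)), §3.1.1.
* [Ribet1980] K. Ribet, *Division fields of abelian varieties with complex multiplication*, Mém. SMF 2 (1980)
  75–94, §3 Cor. (3.6).
-/

set_option autoImplicit false

open scoped Pointwise symmDiff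

namespace Literature.NumberTheory.ComplexMultiplication

section GroupLevel

variable {G : Type*} [Group G] {E : Type*} [MulAction G E] {ρ : G} {Φ : Set E}
variable {P : Type*} [MulAction G P] {π : E → P}

namespace IsCMTypeWith

/-! ### The pair space `π : E → P` (fibres = the pairs `{x, ρx}`) and the flipped pairs of an element of `(ℤ₂)ᵛ` -/

/-- In a fibre of `π` both points are flipped by `g ∈ (ℤ₂)ᵛ` or none is: `g(ρx) = ρ(gx)`.
[cite: Dodson1984, §1.1 Proposition (proof)] -/
theorem smul_rho_smul_eq_iff (h : IsCMTypeWith ρ Φ) (g : G) (x : E) : g • ρ • x = ρ • ρ • x ↔ g • x = ρ • x := by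
  rw [h.comm, h.invol]
  constructor
  · intro h1
    have := congrArg (ρ • ·) h1
    simpa only [h.invol] using this
  · intro h1; rw [h1, h.invol]

omit [MulAction G P] in
open scoped Classical in
/-- Membership in the set of flipped pairs: `π x` is flipped by `g ∈ (ℤ₂)ᵛ` iff `gx = ρx` (independent of the choice of
`x` in the pair). [cite: Dodson1984, §1.1 Imprimitivity Theorem (2)] -/
theorem mem_filter_flip_iff (h : IsCMTypeWith ρ Φ) [Fintype P] (hπ : ∀ x y : E, π x = π y ↔ y = x ∨ y = ρ • x)
    (g : G) (x : E) :
    π x ∈ (Finset.univ.filter fun p : P => ∀ y : E, π y = p → g • y = ρ • y) ↔ g • x = ρ • x := by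
  simp only [Finset.mem_filter, Finset.mem_univ, true_and]
  constructor
  · intro hx; exact hx x rfl
  · intro hx y hy
    rcases (hπ x y).1 hy.symm with rfl | rfl
    · exact hx
    · rwa [h.smul_rho_smul_eq_iff]

omit [MulAction G P] in
open scoped Classical in
/-- **The coordinates are a homomorphism `(ℤ₂)ᵛ → (ℤ₂)ⁿ`**: the pairs flipped by `gg′` are the symmetric difference.
[cite: Dodson1984, §1.1 Imprimitivity Theorem (2)] -/
theorem filter_flip_mul (h : IsCMTypeWith ρ Φ) [Fintype P] (hπ : ∀ x y : E, π x = π y ↔ y = x ∨ y = ρ • x)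
    (hπs : Function.Surjective π) {V : Subgroup G} (hV : ∀ g : G, g ∈ V ↔ ∀ x : E, g • x = x ∨ g • x = ρ • x)
    {g g' : G} (hg : g ∈ V) (hg' : g' ∈ V) :
    (Finset.univ.filter fun p : P => ∀ y : E, π y = p → (g * g') • y = ρ • y) =
      (Finset.univ.filter fun p : P => ∀ y : E, π y = p → g • y = ρ • y) ∆
        (Finset.univ.filter fun p : P => ∀ y : E, π y = p → g' • y = ρ • y) := by
  ext p
  obtain ⟨x, rfl⟩ := hπs p
  rw [Finset.mem_symmDiff, h.mem_filter_flip_iff hπ, h.mem_filter_flip_iff hπ, h.mem_filter_flip_iff hπ, mul_smul]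
  have hρx : ρ • x ≠ x := h.rho_smul_ne x
  rcases (hV g').1 hg' x with h1 | h1 <;> rw [h1]
  · -- `g' x = x`
    constructor
    · intro h2; exact Or.inl ⟨h2, fun h3 => hρx h3.symm⟩
    · rintro (⟨h2, -⟩ | ⟨h2, -⟩)
      · exact h2
      · exact absurd h2.symm hρx
  · -- `g' x = ρx`
    rw [h.comm g x]
    rcases (hV g).1 hg x with h2 | h2 <;> rw [h2]
    · exact ⟨fun _ => Or.inr ⟨rfl, fun h3 => hρx h3.symm⟩, fun _ => rfl⟩
    · rw [h.invol]
      exact ⟨fun h3 => absurd h3.symm hρx, fun h3 => h3.elim (fun h4 => absurd h4.1 h4.2) fun h4 => absurd h4.1 h4.2⟩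

open scoped Classical in
/-- **`G` acts on the coordinates by permuting them**: the pairs flipped by `cgc⁻¹` are the `c`-translates of the pairs
flipped by `g`. [cite: Dodson1984, §1.1 Imprimitivity Theorem (2)] -/
theorem filter_flip_conj (h : IsCMTypeWith ρ Φ) [Fintype P] (hπ : ∀ x y : E, π x = π y ↔ y = x ∨ y = ρ • x)
    (hπs : Function.Surjective π) (hπG : ∀ (g : G) (x : E), π (g • x) = g • π x) (g c : G) :
    (Finset.univ.filter fun p : P => ∀ y : E, π y = p → (c * g * c⁻¹) • y = ρ • y) =
      c • (Finset.univ.filter fun p : P => ∀ y : E, π y = p → g • y = ρ • y) := by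
  ext p
  obtain ⟨x, rfl⟩ := hπs p
  rw [h.mem_filter_flip_iff hπ, Finset.mem_smul_finset]
  constructor
  · intro hx
    refine ⟨π (c⁻¹ • x), (h.mem_filter_flip_iff hπ g _).2 ?_, by rw [← hπG, smul_inv_smul]⟩
    have h1 : x ∈ {y : E | (c * g * c⁻¹) • y = ρ • y} := hx
    rw [h.setOf_conj_smul_eq_rho_smul, Set.mem_smul_set_iff_inv_smul_mem] at h1
    exact h1
  · rintro ⟨q, hq, hqx⟩
    obtain ⟨y, rfl⟩ := hπs q
    rw [← hπG] at hqx
    have hy := (h.mem_filter_flip_iff hπ g y).1 hq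
    rcases (hπ (c • y) x).1 hqx with rfl | rfl
    · change (c * g * c⁻¹) • c • y = ρ • c • y
      rw [mul_smul, mul_smul, inv_smul_smul, hy, h.comm]
    · rw [h.smul_rho_smul_eq_iff]
      rw [mul_smul, mul_smul, inv_smul_smul, hy, h.comm]

omit [MulAction G P] in
open scoped Classical in
/-- **The coordinates are injective** (faithful action): an element of `(ℤ₂)ᵛ` is determined by the pairs it flips.
[cite: Dodson1984, §1.1 Proposition (proof)] -/
theorem eq_of_filter_flip_eq [FaithfulSMul G E] (h : IsCMTypeWith ρ Φ) [Fintype P]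
    (hπ : ∀ x y : E, π x = π y ↔ y = x ∨ y = ρ • x) {V : Subgroup G}
    (hV : ∀ g : G, g ∈ V ↔ ∀ x : E, g • x = x ∨ g • x = ρ • x) {g g' : G} (hg : g ∈ V) (hg' : g' ∈ V)
    (heq : (Finset.univ.filter fun p : P => ∀ y : E, π y = p → g • y = ρ • y) =
      (Finset.univ.filter fun p : P => ∀ y : E, π y = p → g' • y = ρ • y)) : g = g' := by
  refine eq_of_smul_eq_smul (α := E) fun x => ?_
  have key : g • x = ρ • x ↔ g' • x = ρ • x := by
    rw [← h.mem_filter_flip_iff hπ g x, ← h.mem_filter_flip_iff hπ g' x, heq]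
  have hρx : ρ • x ≠ x := h.rho_smul_ne x
  rcases (hV g).1 hg x with h1 | h1 <;> rcases (hV g').1 hg' x with h2 | h2
  · rw [h1, h2]
  · exact absurd ((key.2 h2).symm.trans h1) hρx
  · exact absurd ((key.1 h1).symm.trans h2) hρx
  · rw [h1, h2]

omit [MulAction G P] in
open scoped Classical in
/-- `ρ` flips every pair. [cite: Dodson1984, §1.1 Proposition (proof: "`ρ` has image `(1, …, 1)`")] -/
theorem filter_flip_rho [Fintype P] (ρ : G) :
    (Finset.univ.filter fun p : P => ∀ y : E, π y = p → ρ • y = ρ • y) = Finset.univ :=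
  Finset.filter_true_of_mem fun _ _ _ _ => rfl

omit [MulAction G P] in
open scoped Classical in
/-- `1` flips no pair. [cite: Dodson1984, §1.1 Proposition (proof)] -/
theorem filter_flip_one (h : IsCMTypeWith ρ Φ) [Fintype P] (hπs : Function.Surjective π) :
    (Finset.univ.filter fun p : P => ∀ y : E, π y = p → (1 : G) • y = ρ • y) = ∅ := by
  refine Finset.filter_false_of_mem fun p _ hp => ?_
  obtain ⟨x, rfl⟩ := hπs p
  have := hp x rfl
  rw [one_smul] at this
  exact h.rho_smul_ne x this.symm

/-! ### `G` with image `⊇ Alt(P)` moves any set of pairs onto any other of the same size -/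

open scoped Classical in
/-- If the image of `G` in `Sym(P)` contains the alternating group and `|P| ≥ 3`, `G` is `k`-homogeneous on `P` for
every `k` (Mathlib `Set.powersetCard.isPretransitive_alternatingGroup`). [cite: Dodson1987, Prop. 2.1 (proof)] -/
theorem exists_smul_finset_eq_of_alternatingGroup_le [Fintype P]
    (hA : alternatingGroup P ≤ (MulAction.toPermHom G P).range) (h3 : 3 ≤ Fintype.card P) {T T' : Finset P}
    (hTT' : T.card = T'.card) : ∃ σ : G, σ • T = T' := by
  have h3' : 3 ≤ Nat.card P := by rwa [Nat.card_eq_fintype_card]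
  haveI := Set.powersetCard.isPretransitive_alternatingGroup (α := P) (n := T'.card) h3'
  obtain ⟨τ, hτ⟩ := MulAction.exists_smul_eq (alternatingGroup P)
    (⟨T, Set.powersetCard.mem_iff.2 hTT'⟩ : Set.powersetCard P T'.card) ⟨T', Set.powersetCard.mem_iff.2 rfl⟩
  have hτT : τ • T = T' := congrArg Subtype.val hτ
  obtain ⟨σ, hσ⟩ := hA τ.2
  refine ⟨σ, ?_⟩
  rw [← hτT]
  ext p
  have hσp : ∀ q : P, σ • q = (τ : Equiv.Perm P) q := fun q => by
    have := congrArg (fun f : Equiv.Perm P => f q) hσ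
    simpa only [MulAction.toPermHom_apply, MulAction.toPerm_apply] using this
  rw [Finset.mem_smul_finset, Finset.mem_smul_finset]
  constructor
  · rintro ⟨q, hq, rfl⟩; exact ⟨q, hq, (hσp q).symm⟩
  · rintro ⟨q, hq, rfl⟩; exact ⟨q, hq, hσp q⟩

/-! ### From one element of `(ℤ₂)ᵛ` other than `1, ρ` to all even subsets -/

section Alternating

variable [FaithfulSMul G E] [Fintype P]

omit [FaithfulSMul G E] in
open scoped Classical in
/-- **Transport of a coordinate vector**: if some `g ∈ (ℤ₂)ᵛ` flips a set of pairs of size `k`, then EVERY set of `k`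
pairs is the flip set of an element of `(ℤ₂)ᵛ` (conjugate by `G ⊇ Aₙ`, which is `k`-homogeneous).
[cite: Dodson1987, Prop. 2.1 (proof)] [cite: Dodson1984, §1.1 Imprimitivity Theorem (2)] -/
theorem exists_filter_flip_eq_of_card_eq (h : IsCMTypeWith ρ Φ) (hπ : ∀ x y : E, π x = π y ↔ y = x ∨ y = ρ • x)
    (hπs : Function.Surjective π) (hπG : ∀ (g : G) (x : E), π (g • x) = g • π x) {V : Subgroup G}
    (hV : ∀ g : G, g ∈ V ↔ ∀ x : E, g • x = x ∨ g • x = ρ • x)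
    (hA : alternatingGroup P ≤ (MulAction.toPermHom G P).range) (h3 : 3 ≤ Fintype.card P) {g : G} (hg : g ∈ V)
    (T : Finset P) (hT : T.card = (Finset.univ.filter fun p : P => ∀ y : E, π y = p → g • y = ρ • y).card) :
    ∃ g' ∈ V, (Finset.univ.filter fun p : P => ∀ y : E, π y = p → g' • y = ρ • y) = T := by
  haveI := h.pairKernel_normal hV
  obtain ⟨σ, hσ⟩ := exists_smul_finset_eq_of_alternatingGroup_le hA h3 hT.symm
  exact ⟨σ * g * σ⁻¹, Subgroup.Normal.conj_mem inferInstance g hg σ, by rw [h.filter_flip_conj hπ hπs hπG, hσ]⟩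

open scoped Classical in
/-- **An element of `(ℤ₂)ᵛ` other than `1` and `ρ` yields one flipping exactly TWO pairs** (`|P| ≥ 3`, `G ⊇ Aₙ` on
the pairs): with `S` its flip set (`∅ ≠ S ≠ P`), transport `S` to `S − a + b` and multiply.
[cite: Dodson1987, Prop. 2.1 (proof)] -/
theorem exists_filter_flip_card_eq_two (h : IsCMTypeWith ρ Φ) (hπ : ∀ x y : E, π x = π y ↔ y = x ∨ y = ρ • x)
    (hπs : Function.Surjective π) (hπG : ∀ (g : G) (x : E), π (g • x) = g • π x) {V : Subgroup G}
    (hV : ∀ g : G, g ∈ V ↔ ∀ x : E, g • x = x ∨ g • x = ρ • x)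
    (hA : alternatingGroup P ≤ (MulAction.toPermHom G P).range) (h3 : 3 ≤ Fintype.card P) {g : G} (hg : g ∈ V)
    (hg1 : g ≠ 1) (hgρ : g ≠ ρ) :
    ∃ g' ∈ V, (Finset.univ.filter fun p : P => ∀ y : E, π y = p → g' • y = ρ • y).card = 2 := by
  set S := Finset.univ.filter fun p : P => ∀ y : E, π y = p → g • y = ρ • y with hS_def
  -- `S ≠ ∅` and `S ≠ univ`
  have hSne : S.Nonempty := by
    rw [Finset.nonempty_iff_ne_empty]
    intro hS
    exact hg1 (h.eq_of_filter_flip_eq hπ hV hg V.one_mem (by rw [h.filter_flip_one hπs]; exact hS))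
  have hSnu : S ≠ Finset.univ := by
    intro hS
    exact hgρ (h.eq_of_filter_flip_eq hπ hV hg (rho_mem_of_pairKernel hV) (by rw [filter_flip_rho]; exact hS))
  obtain ⟨a, ha⟩ := hSne
  obtain ⟨b, hb⟩ : ∃ b, b ∉ S := by
    by_contra hno
    push Not at hno
    exact hSnu (Finset.eq_univ_of_forall hno)
  -- `T = S − a + b` has the same size
  set T := insert b (S.erase a) with hT_def
  have hbS' : b ∉ S.erase a := fun h1 => hb (Finset.mem_of_mem_erase h1)
  have hTcard : T.card = S.card := by
    rw [hT_def, Finset.card_insert_of_notMem hbS', Finset.card_erase_of_mem ha]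
    have := Finset.card_pos.2 ⟨a, ha⟩
    omega
  obtain ⟨g', hg'V, hg'T⟩ := h.exists_filter_flip_eq_of_card_eq hπ hπs hπG hV hA h3 hg T hTcard
  refine ⟨g * g', V.mul_mem hg hg'V, ?_⟩
  rw [h.filter_flip_mul hπ hπs hV hg hg'V, hg'T, ← hS_def]
  -- `S ∆ (S − a + b) = {a, b}`
  have hab : a ≠ b := fun h1 => hb (h1 ▸ ha)
  have hsd : S ∆ T = {a, b} := by
    ext p
    rw [Finset.mem_symmDiff, hT_def, Finset.mem_insert, Finset.mem_erase, Finset.mem_insert, Finset.mem_singleton]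
    by_cases hpa : p = a
    · subst hpa; simp [ha, hab]
    · by_cases hpb : p = b
      · subst hpb; simp [hb]
      · simp [hpa, hpb]
  rw [hsd, Finset.card_pair hab]

open scoped Classical in
/-- **Every EVEN set of pairs is a flip set** once `(ℤ₂)ᵛ ∌` only `1, ρ` (`|P| ≥ 3`, `G ⊇ Aₙ` on the pairs): all
`2`-sets by transport, then products. [cite: Dodson1987, Prop. 2.1 (proof)] -/
theorem exists_filter_flip_eq_of_even (h : IsCMTypeWith ρ Φ) (hπ : ∀ x y : E, π x = π y ↔ y = x ∨ y = ρ • x)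
    (hπs : Function.Surjective π) (hπG : ∀ (g : G) (x : E), π (g • x) = g • π x) {V : Subgroup G}
    (hV : ∀ g : G, g ∈ V ↔ ∀ x : E, g • x = x ∨ g • x = ρ • x)
    (hA : alternatingGroup P ≤ (MulAction.toPermHom G P).range) (h3 : 3 ≤ Fintype.card P) {g : G} (hg : g ∈ V)
    (hg1 : g ≠ 1) (hgρ : g ≠ ρ) (T : Finset P) (hT : Even T.card) :
    ∃ g' ∈ V, (Finset.univ.filter fun p : P => ∀ y : E, π y = p → g' • y = ρ • y) = T := by
  obtain ⟨g₂, hg₂, hg₂card⟩ := h.exists_filter_flip_card_eq_two hπ hπs hπG hV hA h3 hg hg1 hgρ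
  -- induction on the size of `T`
  induction' hN : T.card using Nat.strong_induction_on with N ih generalizing T
  rcases Nat.eq_zero_or_pos N with rfl | hNpos
  · refine ⟨1, V.one_mem, ?_⟩
    rw [h.filter_flip_one hπs, eq_comm, ← Finset.card_eq_zero, hN]
  · -- `|T| ≥ 2`: remove two points
    have h2 : 2 ≤ T.card := by
      obtain ⟨m, hm⟩ := hT; omega
    obtain ⟨a, b, haT, hbT, hab⟩ := Finset.one_lt_card_iff.1 (show 1 < T.card by omega)
    set T' := (T.erase a).erase b with hT'_def
    have hbT' : b ∈ T.erase a := Finset.mem_erase.2 ⟨hab.symm, hbT⟩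
    have hT'card : T'.card = T.card - 2 := by
      rw [hT'_def, Finset.card_erase_of_mem hbT', Finset.card_erase_of_mem haT]; omega
    obtain ⟨g', hg'V, hg'T'⟩ := ih T'.card (by omega) T' (by
      rw [hT'card]; obtain ⟨m, hm⟩ := hT; exact ⟨m - 1, by omega⟩) rfl
    obtain ⟨gab, hgabV, hgab⟩ := h.exists_filter_flip_eq_of_card_eq hπ hπs hπG hV hA h3 hg₂ {a, b}
      (by rw [Finset.card_pair hab, hg₂card])
    refine ⟨g' * gab, V.mul_mem hg'V hgabV, ?_⟩
    rw [h.filter_flip_mul hπ hπs hV hg'V hgabV, hg'T', hgab]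
    -- `T' ∆ {a, b} = T`
    ext p
    rw [Finset.mem_symmDiff, hT'_def, Finset.mem_erase, Finset.mem_erase, Finset.mem_insert, Finset.mem_singleton]
    by_cases hpa : p = a
    · subst hpa; simp [haT]
    · by_cases hpb : p = b
      · subst hpb; simp [hbT]
      · simp [hpa, hpb]

open scoped Classical in
/-- **For `n = |P|` ODD every set of pairs is a flip set** (the complement of an odd set is even, and `ρ` flips
everything). [cite: Dodson1987, Prop. 2.1 (proof)] -/
theorem exists_filter_flip_eq_of_odd (h : IsCMTypeWith ρ Φ) (hπ : ∀ x y : E, π x = π y ↔ y = x ∨ y = ρ • x)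
    (hπs : Function.Surjective π) (hπG : ∀ (g : G) (x : E), π (g • x) = g • π x) {V : Subgroup G}
    (hV : ∀ g : G, g ∈ V ↔ ∀ x : E, g • x = x ∨ g • x = ρ • x)
    (hA : alternatingGroup P ≤ (MulAction.toPermHom G P).range) (h3 : 3 ≤ Fintype.card P)
    (hodd : Odd (Fintype.card P)) {g : G} (hg : g ∈ V) (hg1 : g ≠ 1) (hgρ : g ≠ ρ) (T : Finset P) :
    ∃ g' ∈ V, (Finset.univ.filter fun p : P => ∀ y : E, π y = p → g' • y = ρ • y) = T := by
  rcases Nat.even_or_odd T.card with hT | hT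
  · exact h.exists_filter_flip_eq_of_even hπ hπs hπG hV hA h3 hg hg1 hgρ T hT
  · have hTc : Even Tᶜ.card := by
      rw [Finset.card_compl]
      obtain ⟨m, hm⟩ := hodd; obtain ⟨k, hk⟩ := hT
      have := Finset.card_le_univ T
      exact ⟨m - k, by omega⟩
    obtain ⟨g', hg'V, hg'T⟩ := h.exists_filter_flip_eq_of_even hπ hπs hπG hV hA h3 hg hg1 hgρ Tᶜ hTc
    refine ⟨g' * ρ, V.mul_mem hg'V (rho_mem_of_pairKernel hV), ?_⟩
    rw [h.filter_flip_mul hπ hπs hV hg'V (rho_mem_of_pairKernel hV), hg'T, filter_flip_rho]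
    ext p
    simp [Finset.mem_symmDiff]

/-! ### The dichotomy `v = 1` or `v = n` for `n` odd -/

omit [FaithfulSMul G E] [MulAction G P] in
/-- The number of pairs is `n = |E|/2`: a CM type is a transversal of `π`. [cite: Dodson1984, §1.1 Proposition] -/
theorem card_pairSpace_eq [Fintype E] (h : IsCMTypeWith ρ Φ) (hπ : ∀ x y : E, π x = π y ↔ y = x ∨ y = ρ • x)
    (hπs : Function.Surjective π) : Fintype.card P = Fintype.card E / 2 := by
  classical
  -- `π` restricted to `Φ` is a bijection onto `P`
  have hbij : Function.Bijective fun x : Φ => π (x : E) := by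
    constructor
    · rintro ⟨x, hx⟩ ⟨y, hy⟩ hxy
      rcases (hπ x y).1 hxy with rfl | rfl
      · rfl
      · exact absurd hy ((h.mem_iff x).1 hx)
    · intro p
      obtain ⟨x, rfl⟩ := hπs p
      by_cases hx : x ∈ Φ
      · exact ⟨⟨x, hx⟩, rfl⟩
      · exact ⟨⟨ρ • x, (h.rho_smul_mem_iff x).2 hx⟩, ((hπ x (ρ • x)).2 (Or.inr rfl)).symm⟩
  have h1 := Fintype.card_of_bijective hbij
  have h2 := two_mul_ncard_eq_card_of_cm (c := ρ) h.mem_iff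
  rw [Nat.card_eq_fintype_card, ← Nat.card_coe_set_eq, Nat.card_eq_fintype_card, h1] at h2
  omega

open scoped Classical in
/-- **Dodson 1987, Prop. 2.1, first step, at group level.**  If `G ⊇ Aₙ` on the `n` pairs (`n ≥ 3` ODD) then
either the pair kernel is `{1, ρ}` (`v = 1`) or it has `2ⁿ` elements (`v = n`: "a single `Gal(Kᶜ/ℚ)`-orbit of types
of order `2ⁿ`", the tree's `orbit_eq_setOf_isCMTypeWith_of_card_pairKernel_eq`). [cite: Dodson1987, Prop. 2.1 (proof)] -/
theorem pairKernel_subset_or_card_eq_two_pow [Finite E] [Finite G] (h : IsCMTypeWith ρ Φ)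
    (hπ : ∀ x y : E, π x = π y ↔ y = x ∨ y = ρ • x) (hπs : Function.Surjective π)
    (hπG : ∀ (g : G) (x : E), π (g • x) = g • π x) {V : Subgroup G}
    (hV : ∀ g : G, g ∈ V ↔ ∀ x : E, g • x = x ∨ g • x = ρ • x)
    (hA : alternatingGroup P ≤ (MulAction.toPermHom G P).range) (h3 : 3 ≤ Fintype.card P)
    (hodd : Odd (Fintype.card P)) :
    (∀ g ∈ V, g = 1 ∨ g = ρ) ∨ Nat.card V = 2 ^ (Nat.card E / 2) := by
  by_cases hsmall : ∀ g ∈ V, g = 1 ∨ g = ρ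
  · exact Or.inl hsmall
  · right
    push Not at hsmall
    obtain ⟨g, hg, hg1, hgρ⟩ := hsmall
    refine le_antisymm (h.card_pairKernel_le_two_pow hV) ?_
    -- the coordinate map `V → Finset P` is onto
    let F : V → Finset P := fun g' => Finset.univ.filter fun p : P => ∀ y : E, π y = p → (g' : G) • y = ρ • y
    have hF : Function.Surjective F := fun T => by
      obtain ⟨g', hg'V, hg'T⟩ := h.exists_filter_flip_eq_of_odd hπ hπs hπG hV hA h3 hodd hg hg1 hgρ T
      exact ⟨⟨g', hg'V⟩, hg'T⟩
    have hle := Nat.card_le_card_of_surjective F hF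
    haveI : Fintype E := Fintype.ofFinite E
    rw [Nat.card_eq_fintype_card (α := Finset P), Fintype.card_finset, h.card_pairSpace_eq hπ hπs,
      ← Nat.card_eq_fintype_card] at hle
    exact hle

open scoped Classical in
/-- **Hence, in the second case, EVERY CM type is nondegenerate** (`Rank = n + 1`: the tree's
`typeRank_eq_of_card_pairKernel_eq`, Ribet's Cor. 3.6 on the single orbit). [cite: Dodson1987, Prop. 2.1 (proof)]
[cite: Ribet1980, §3 Cor. (3.6) (p. 87)] -/
theorem typeRank_eq_of_not_pairKernel_subset [Fintype E] [Finite G] [MulAction.IsPretransitive G E]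
    (h : IsCMTypeWith ρ Φ) (hπ : ∀ x y : E, π x = π y ↔ y = x ∨ y = ρ • x) (hπs : Function.Surjective π)
    (hπG : ∀ (g : G) (x : E), π (g • x) = g • π x) {V : Subgroup G}
    (hV : ∀ g : G, g ∈ V ↔ ∀ x : E, g • x = x ∨ g • x = ρ • x)
    (hA : alternatingGroup P ≤ (MulAction.toPermHom G P).range)
    (h3 : 3 ≤ Fintype.card P) (hodd : Odd (Fintype.card P)) (hbig : ∃ g ∈ V, g ≠ 1 ∧ g ≠ ρ) {Ψ : Set E}
    (hΨ : IsCMTypeWith ρ Ψ) : typeRank G Ψ = Fintype.card E / 2 + 1 := by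
  haveI : Nonempty E := by
    by_contra hE
    rw [not_nonempty_iff] at hE
    have : Fintype.card P = 0 := by rw [h.card_pairSpace_eq hπ hπs, Fintype.card_eq_zero]
    omega
  rcases h.pairKernel_subset_or_card_eq_two_pow hπ hπs hπG hV hA h3 hodd with h1 | h1
  · obtain ⟨g, hg, hg1, hgρ⟩ := hbig
    rcases h1 g hg with h2 | h2
    · exact absurd h2 hg1
    · exact absurd h2 hgρ
  · rw [Nat.card_eq_fintype_card (α := E)] at h1
    exact hΨ.typeRank_eq_of_card_pairKernel_eq hV h1

end Alternating

/-! ### The sign of `ρ` on the embeddings: `sign_E(ρ) = (−1)ⁿ` -/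

open scoped Classical in
/-- `ρ` is the product of the `n = |E|/2` disjoint transpositions `(x ρx)` (it is a fixed-point-free involution of
the embeddings), so its sign on `E` is `(−1)ⁿ`: for `n` ODD complex conjugation is an odd permutation of the
embeddings. [cite: Dodson1984, §1.1 Proposition (proof: "the automorphism `ρ` giving complex conjugation")] -/
theorem sign_toPerm_rho [Fintype E] (h : IsCMTypeWith ρ Φ) (hodd : Odd (Fintype.card E / 2)) :
    Equiv.Perm.sign (MulAction.toPerm ρ : Equiv.Perm E) = -1 := by
  rcases isEmpty_or_nonempty E with hE | hE
  · exfalso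
    rw [Fintype.card_eq_zero, Nat.zero_div] at hodd
    exact Nat.not_odd_iff_even.2 ⟨0, rfl⟩ hodd
  · set σ : Equiv.Perm E := MulAction.toPerm ρ with hσ_def
    have hσ1 : σ ≠ 1 := by
      intro h1
      obtain ⟨x⟩ := hE
      have := Equiv.ext_iff.1 h1 x
      rw [hσ_def, MulAction.toPerm_apply, Equiv.Perm.one_apply] at this
      exact h.rho_smul_ne x this
    have hσ2 : σ ^ 2 = 1 := by
      ext x
      rw [pow_two, Equiv.Perm.mul_apply, hσ_def, MulAction.toPerm_apply, MulAction.toPerm_apply, h.invol,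
        Equiv.Perm.one_apply]
    have hord : orderOf σ = 2 := orderOf_eq_prime hσ2 hσ1
    obtain ⟨m, hm⟩ := Equiv.Perm.cycleType_prime_order (σ := σ) (by rw [hord]; exact Nat.prime_two)
    rw [hord] at hm
    have hrep : σ.cycleType = Multiset.replicate (Multiset.card σ.cycleType) 2 := by
      rw [hm, Multiset.card_replicate]
    have hfix : Fintype.card (Function.fixedPoints σ) = 0 :=
      Fintype.card_eq_zero_iff.2 ⟨fun x => h.rho_smul_ne x.1 x.2⟩
    rw [Equiv.Perm.sign_of_cycleType_eq_replicate two_pos hrep, if_neg (Nat.not_odd_iff_even.2 even_two), hfix,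
      Nat.sub_zero]
    exact hodd.neg_one_pow

/-! ### An index-`2` subgroup `ker χ ∌ ρ` above `Stab(φ₀)` cuts out a block `E₀` ("`K` contains an imaginary
quadratic subfield `k`": `k = (Kᶜ)^{ker χ} ⊆ (Kᶜ)^{Stab φ₀} = K`, `E₀` = the embeddings inducing a fixed one of `k`) -/

end IsCMTypeWith

/-- `gφ₀ ∈ E₀ = (ker χ)φ₀` iff `χ(g) = 1`, when `Stab(φ₀) ≤ ker χ`. [cite: Dodson1984, §3.1.1 Theorem (proof)] -/
theorem smul_mem_orbit_ker_iff (χ : G →* ℤˣ) {φ₀ : E} (hH : MulAction.stabilizer G φ₀ ≤ χ.ker) (g : G) :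
    g • φ₀ ∈ MulAction.orbit χ.ker φ₀ ↔ χ g = 1 := by
  constructor
  · rintro ⟨k, hk⟩
    have hk' : (k : G) • φ₀ = g • φ₀ := hk
    have h1 : g⁻¹ * (k : G) ∈ MulAction.stabilizer G φ₀ := by
      rw [MulAction.mem_stabilizer_iff, mul_smul, hk', inv_smul_smul]
    have h2 := hH h1
    rw [MonoidHom.mem_ker, map_mul, map_inv, (MonoidHom.mem_ker).1 k.2, mul_one, inv_eq_one] at h2
    exact h2
  · intro hg
    exact ⟨⟨g, (MonoidHom.mem_ker).2 hg⟩, rfl⟩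

namespace IsCMTypeWith

/-- **The block over an imaginary quadratic subfield.**  If `χ : G → {±1}` has `χ(ρ) = −1` and is trivial on
`Stab(φ₀) = Gal(Kᶜ/K)`, the set `E₀ = (ker χ)φ₀` of embeddings is a CM type (`G` transitive): `gφ₀ ∈ E₀ ⟺ χ(g) = 1
⟺ χ(ρg) ≠ 1 ⟺ ρgφ₀ ∉ E₀`. [cite: Dodson1987, Prop. 2.1 (proof: "or else `K` contains an imaginary quadratic
subfield … `e = 0` or `ρ`")] [cite: Dodson1984, §3.1.1] -/
theorem isCMTypeWith_orbit_ker [MulAction.IsPretransitive G E] (h : IsCMTypeWith ρ Φ) (χ : G →* ℤˣ)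
    (hρ : χ ρ = -1) {φ₀ : E} (hH : MulAction.stabilizer G φ₀ ≤ χ.ker) :
    IsCMTypeWith ρ (MulAction.orbit χ.ker φ₀) := by
  refine ⟨fun x => ?_, h.comm, h.invol⟩
  obtain ⟨g, rfl⟩ := MulAction.exists_smul_eq G φ₀ x
  rw [smul_smul, smul_mem_orbit_ker_iff χ hH, smul_mem_orbit_ker_iff χ hH, map_mul, hρ]
  rcases Int.units_eq_one_or (χ g) with h1 | h1 <;> rw [h1] <;> decide

/-- **`G` permutes `{E₀, ρE₀}`**: `gE₀ = E₀` when `χ(g) = 1` and `gE₀ = ρE₀` when `χ(g) = −1` ("in the action on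
types `e = 0` or `ρ`"). [cite: Dodson1987, Prop. 2.1 (proof)] -/
theorem smul_orbit_ker_eq_or [MulAction.IsPretransitive G E] (χ : G →* ℤˣ) (hρ : χ ρ = -1) {φ₀ : E}
    (hH : MulAction.stabilizer G φ₀ ≤ χ.ker) (g : G) :
    g • MulAction.orbit χ.ker φ₀ = MulAction.orbit χ.ker φ₀ ∨
      g • MulAction.orbit χ.ker φ₀ = ρ • MulAction.orbit χ.ker φ₀ := by
  rcases Int.units_eq_one_or (χ g) with hg | hg
  · left
    ext x
    obtain ⟨c, rfl⟩ := MulAction.exists_smul_eq G φ₀ x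
    rw [Set.mem_smul_set_iff_inv_smul_mem, smul_smul, smul_mem_orbit_ker_iff χ hH, smul_mem_orbit_ker_iff χ hH,
      map_mul, map_inv, hg, inv_one, one_mul]
  · right
    ext x
    obtain ⟨c, rfl⟩ := MulAction.exists_smul_eq G φ₀ x
    rw [Set.mem_smul_set_iff_inv_smul_mem, Set.mem_smul_set_iff_inv_smul_mem, smul_smul, smul_smul,
      smul_mem_orbit_ker_iff χ hH, smul_mem_orbit_ker_iff χ hH, map_mul, map_mul, map_inv, map_inv, hg, hρ]

/-! ### `v = 1`, `n` odd and `Ḡ ⊇ Alt(P)` ⟹ such a character exists: `sign_E` or `sign_E · sign_P` -/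

end IsCMTypeWith

/-- **The kernel of `G → Sym(P)` is the pair kernel**: `g` acts trivially on the pairs iff `gx ∈ {x, ρx}` for all
`x`. [cite: Dodson1984, §1.1 Imprimitivity Theorem (2)] -/
theorem toPerm_pairSpace_eq_one_iff (hπ : ∀ x y : E, π x = π y ↔ y = x ∨ y = ρ • x)
    (hπs : Function.Surjective π) (hπG : ∀ (g : G) (x : E), π (g • x) = g • π x) (g : G) :
    (MulAction.toPerm g : Equiv.Perm P) = 1 ↔ ∀ x : E, g • x = x ∨ g • x = ρ • x := by
  constructor
  · intro hg x
    have h1 : g • π x = π x := by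
      have := Equiv.ext_iff.1 hg (π x)
      rwa [MulAction.toPerm_apply, Equiv.Perm.one_apply] at this
    rw [← hπG] at h1
    exact (hπ x (g • x)).1 h1.symm
  · intro hg
    ext p
    obtain ⟨x, rfl⟩ := hπs p
    rw [MulAction.toPerm_apply, Equiv.Perm.one_apply, ← hπG]
    exact ((hπ x (g • x)).2 (hg x)).symm

/-- The same, as membership in `ker(G → Sym(P))`. [cite: Dodson1984, §1.1 Imprimitivity Theorem (2)] -/
theorem mem_ker_toPermHom_pairSpace_iff (hπ : ∀ x y : E, π x = π y ↔ y = x ∨ y = ρ • x)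
    (hπs : Function.Surjective π) (hπG : ∀ (g : G) (x : E), π (g • x) = g • π x) (g : G) :
    g ∈ (MulAction.toPermHom G P).ker ↔ ∀ x : E, g • x = x ∨ g • x = ρ • x := by
  rw [MonoidHom.mem_ker, MulAction.toPermHom_apply, toPerm_pairSpace_eq_one_iff hπ hπs hπG]

/-- The point stabiliser `Alt(P)_{p₀}` is generated by the `3`-cycles fixing `p₀` (it is `Alt(P ∖ {p₀})`, and
alternating groups are generated by their `3`-cycles — Mathlib `Equiv.Perm.closure_three_cycles_eq_alternating`).
[folklore] -/
private theorem mem_closure_isThreeCycle_of_apply_eq {P : Type*} [Fintype P] [DecidableEq P] (p₀ : P)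
    {σ : Equiv.Perm P} (hσA : σ ∈ alternatingGroup P) (hσ : σ p₀ = p₀) :
    σ ∈ Subgroup.closure {τ : Equiv.Perm P | τ.IsThreeCycle ∧ τ p₀ = p₀} := by
  have h₁ : ∀ p, σ p ≠ p₀ ↔ p ≠ p₀ := fun p =>
    not_congr ⟨fun hp => σ.injective (hp.trans hσ.symm), fun hp => by rw [hp, hσ]⟩
  have h₂ : ∀ p, σ p ≠ p → p ≠ p₀ := fun p hp hp0 => hp (by rw [hp0, hσ])
  have hσ' : σ.subtypePerm h₁ ∈ Subgroup.closure {τ : Equiv.Perm {p // p ≠ p₀} | τ.IsThreeCycle} := by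
    rw [Equiv.Perm.closure_three_cycles_eq_alternating, Equiv.Perm.mem_alternatingGroup,
      Equiv.Perm.sign_subtypePerm σ h₁ h₂]
    exact Equiv.Perm.mem_alternatingGroup.1 hσA
  have hmap := Subgroup.mem_map_of_mem (Equiv.Perm.ofSubtype : Equiv.Perm {p // p ≠ p₀} →* Equiv.Perm P) hσ'
  rw [MonoidHom.map_closure, Equiv.Perm.ofSubtype_subtypePerm h₁ h₂] at hmap
  refine Subgroup.closure_mono ?_ hmap
  rintro _ ⟨τ, hτ, rfl⟩
  refine ⟨?_, Equiv.Perm.ofSubtype_apply_of_not_mem τ fun hne => hne rfl⟩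
  change (Equiv.Perm.ofSubtype τ).cycleType = {3}
  rw [Equiv.Perm.cycleType_ofSubtype]
  exact hτ

namespace IsCMTypeWith

/-- **Lifting `Ḡ_{p₀}` to `Stab(φ₀)`**: an element of the image of `G` in `Sym(P)` fixing the pair `p₀ = {φ₀, ρφ₀}`
is the image of an element fixing `φ₀` (of `g` or of `ρg`). [cite: Dodson1984, §1.1 (the types as "a choice of
cosets … under the condition that only one coset is selected from each of the cosets paired by the action of `ρ`")] -/
theorem exists_mem_stabilizer_toPerm_eq (h : IsCMTypeWith ρ Φ) (hπ : ∀ x y : E, π x = π y ↔ y = x ∨ y = ρ • x)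
    (hπs : Function.Surjective π) (hπG : ∀ (g : G) (x : E), π (g • x) = g • π x) (φ₀ : E) {σ : Equiv.Perm P}
    (hσ : σ ∈ (MulAction.toPermHom G P).range) (hσp : σ (π φ₀) = π φ₀) :
    ∃ g ∈ MulAction.stabilizer G φ₀, (MulAction.toPerm g : Equiv.Perm P) = σ := by
  obtain ⟨g, rfl⟩ := hσ
  rw [MulAction.toPermHom_apply, MulAction.toPerm_apply, ← hπG] at hσp
  rcases (hπ φ₀ (g • φ₀)).1 hσp.symm with h1 | h1
  · exact ⟨g, MulAction.mem_stabilizer_iff.2 h1, rfl⟩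
  · refine ⟨ρ * g, MulAction.mem_stabilizer_iff.2 (by rw [mul_smul, h1, h.invol]), ?_⟩
    rw [← MulAction.toPermHom_apply, map_mul, MulAction.toPermHom_apply, MulAction.toPermHom_apply,
      (toPerm_pairSpace_eq_one_iff hπ hπs hπG ρ).2 fun x => Or.inr rfl, one_mul]

/-- **`v = 1` ⟹ `Stab(φ₀) → Sym(P)` is injective**: an element fixing `φ₀` and every pair is `1` (it is `1` or
`ρ`, and `ρφ₀ ≠ φ₀`). [cite: Dodson1987, Prop. 2.1 (proof)] -/
theorem eq_one_of_mem_stabilizer_of_toPerm_eq_one (h : IsCMTypeWith ρ Φ)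
    (hπ : ∀ x y : E, π x = π y ↔ y = x ∨ y = ρ • x) (hπs : Function.Surjective π)
    (hπG : ∀ (g : G) (x : E), π (g • x) = g • π x)
    (hV1 : ∀ g : G, (∀ x : E, g • x = x ∨ g • x = ρ • x) → g = 1 ∨ g = ρ) {φ₀ : E} {g : G}
    (hg : g ∈ MulAction.stabilizer G φ₀) (hg1 : (MulAction.toPerm g : Equiv.Perm P) = 1) : g = 1 := by
  rcases hV1 g ((toPerm_pairSpace_eq_one_iff hπ hπs hπG g).1 hg1) with h1 | h1
  · exact h1
  · exfalso
    rw [h1] at hg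
    exact h.rho_smul_ne φ₀ (MulAction.mem_stabilizer_iff.1 hg)

section Sign

variable [Fintype E] [Fintype P]

open scoped Classical in
/-- A lift to `Stab(φ₀)` of a `3`-CYCLE of the pairs has order `3` (`v = 1`), hence sign `+1` on the embeddings.
[cite: Dodson1987, Prop. 2.1 (proof)] -/
theorem sign_toPerm_eq_one_of_isThreeCycle (h : IsCMTypeWith ρ Φ)
    (hπ : ∀ x y : E, π x = π y ↔ y = x ∨ y = ρ • x) (hπs : Function.Surjective π)
    (hπG : ∀ (g : G) (x : E), π (g • x) = g • π x)
    (hV1 : ∀ g : G, (∀ x : E, g • x = x ∨ g • x = ρ • x) → g = 1 ∨ g = ρ) {φ₀ : E} {g : G}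
    (hg : g ∈ MulAction.stabilizer G φ₀) (h3 : (MulAction.toPerm g : Equiv.Perm P).IsThreeCycle) :
    Equiv.Perm.sign (MulAction.toPerm g : Equiv.Perm E) = 1 := by
  have hg3 : g ^ 3 = 1 := by
    refine h.eq_one_of_mem_stabilizer_of_toPerm_eq_one hπ hπs hπG hV1 (Subgroup.pow_mem _ hg 3) ?_
    rw [← MulAction.toPermHom_apply, map_pow, MulAction.toPermHom_apply, ← h3.orderOf, pow_orderOf_eq_one]
  set χ₁ : G →* ℤˣ := Equiv.Perm.sign.comp (MulAction.toPermHom G E) with hχ₁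
  have e : χ₁ g ^ 3 = 1 := by rw [← map_pow, hg3, map_one]
  change χ₁ g = 1
  rcases Int.units_eq_one_or (χ₁ g) with h1 | h1
  · exact h1
  · rw [h1] at e
    exact absurd e (by decide)

open scoped Classical in
/-- **Even on the pairs ⟹ even on the embeddings** (on `Stab(φ₀)`, for `v = 1` and `Ḡ ⊇ Alt(P)`): the elements of
`Stab(φ₀)` that are even on `P` form a copy of `Alt(P)_{p₀}`, generated by lifts of `3`-cycles, which have order `3`.
[cite: Dodson1987, Prop. 2.1 (proof)] -/
theorem sign_toPerm_eq_one_of_sign_eq_one (h : IsCMTypeWith ρ Φ)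
    (hπ : ∀ x y : E, π x = π y ↔ y = x ∨ y = ρ • x) (hπs : Function.Surjective π)
    (hπG : ∀ (g : G) (x : E), π (g • x) = g • π x)
    (hV1 : ∀ g : G, (∀ x : E, g • x = x ∨ g • x = ρ • x) → g = 1 ∨ g = ρ)
    (hA : alternatingGroup P ≤ (MulAction.toPermHom G P).range) {φ₀ : E} {g : G}
    (hg : g ∈ MulAction.stabilizer G φ₀) (hs : Equiv.Perm.sign (MulAction.toPerm g : Equiv.Perm P) = 1) :
    Equiv.Perm.sign (MulAction.toPerm g : Equiv.Perm E) = 1 := by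
  set T := {τ : Equiv.Perm P | τ.IsThreeCycle ∧ τ (π φ₀) = π φ₀} with hT_def
  have hT1 : Subgroup.closure T ≤ (MulAction.toPermHom G P).range :=
    (Subgroup.closure_le _).2 fun τ hτ => hA hτ.1.mem_alternatingGroup
  have hT2 : ∀ τ ∈ Subgroup.closure T, τ (π φ₀) = π φ₀ := by
    intro τ hτ
    have hle : Subgroup.closure T ≤ MulAction.stabilizer (Equiv.Perm P) (π φ₀) :=
      (Subgroup.closure_le _).2 fun τ hτ => MulAction.mem_stabilizer_iff.2 hτ.2
    exact MulAction.mem_stabilizer_iff.1 (hle hτ)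
  have key : ∀ σ ∈ Subgroup.closure T, ∀ k ∈ MulAction.stabilizer G φ₀,
      (MulAction.toPerm k : Equiv.Perm P) = σ → Equiv.Perm.sign (MulAction.toPerm k : Equiv.Perm E) = 1 := by
    intro σ hσ
    induction hσ using Subgroup.closure_induction with
    | mem τ hτ =>
      intro k hk hkτ
      exact h.sign_toPerm_eq_one_of_isThreeCycle hπ hπs hπG hV1 hk (by rw [hkτ]; exact hτ.1)
    | one =>
      intro k hk hk1
      rw [h.eq_one_of_mem_stabilizer_of_toPerm_eq_one hπ hπs hπG hV1 hk hk1, MulAction.toPerm_one,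
        Equiv.Perm.sign_one]
    | mul σ₁ σ₂ hσ₁ hσ₂ ih₁ ih₂ =>
      intro k hk hk12
      obtain ⟨k₁, hk₁, hk₁σ⟩ := h.exists_mem_stabilizer_toPerm_eq hπ hπs hπG φ₀ (hT1 hσ₁) (hT2 σ₁ hσ₁)
      have hk₂ : k₁⁻¹ * k ∈ MulAction.stabilizer G φ₀ := Subgroup.mul_mem _ (Subgroup.inv_mem _ hk₁) hk
      have hk₂σ : (MulAction.toPerm (k₁⁻¹ * k) : Equiv.Perm P) = σ₂ := by
        rw [← MulAction.toPermHom_apply, map_mul, map_inv, MulAction.toPermHom_apply, MulAction.toPermHom_apply,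
          hk₁σ, hk12, inv_mul_cancel_left]
      have e1 := ih₁ k₁ hk₁ hk₁σ
      have e2 := ih₂ _ hk₂ hk₂σ
      rw [← mul_inv_cancel_left k₁ k, ← MulAction.toPermHom_apply, map_mul, map_mul, MulAction.toPermHom_apply,
        e1, one_mul, MulAction.toPermHom_apply, e2]
    | inv σ hσ ih =>
      intro k hk hkσ
      have hk'σ : (MulAction.toPerm k⁻¹ : Equiv.Perm P) = σ := by
        rw [← MulAction.toPermHom_apply, map_inv, MulAction.toPermHom_apply, hkσ, inv_inv]
      have e := ih k⁻¹ (Subgroup.inv_mem _ hk) hk'σ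
      rw [← MulAction.toPermHom_apply, map_inv, MulAction.toPermHom_apply, map_inv, inv_eq_one] at e
      exact e
  refine key _ ?_ g hg rfl
  exact mem_closure_isThreeCycle_of_apply_eq (π φ₀) (Equiv.Perm.mem_alternatingGroup.2 hs)
    (by rw [MulAction.toPerm_apply, ← hπG, MulAction.mem_stabilizer_iff.1 hg])

open scoped Classical in
/-- **`v = 1`, `n` odd, `Ḡ ⊇ Alt(P)` ⟹ `K` contains an imaginary quadratic subfield**: there is a character
`χ : G → {±1}` with `χ(ρ) = −1` trivial on `Stab(φ₀) = Gal(Kᶜ/K)` — namely `sign_E` or `sign_E · sign_P`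
(`sign_E(ρ) = (−1)ⁿ = −1`, `sign_P(ρ) = 1`, and on `Stab(φ₀)` the character `sign_E` is `1` or `sign_P`).
[cite: Dodson1987, Prop. 2.1 (proof: "By [9, Proposition 2.2.2] … or else `K` contains an imaginary quadratic
subfield")] -/
theorem exists_monoidHom_stabilizer_le_ker (h : IsCMTypeWith ρ Φ)
    (hπ : ∀ x y : E, π x = π y ↔ y = x ∨ y = ρ • x) (hπs : Function.Surjective π)
    (hπG : ∀ (g : G) (x : E), π (g • x) = g • π x)
    (hV1 : ∀ g : G, (∀ x : E, g • x = x ∨ g • x = ρ • x) → g = 1 ∨ g = ρ)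
    (hA : alternatingGroup P ≤ (MulAction.toPermHom G P).range) (hodd : Odd (Fintype.card P)) (φ₀ : E) :
    ∃ χ : G →* ℤˣ, χ ρ = -1 ∧ MulAction.stabilizer G φ₀ ≤ χ.ker := by
  set χ₁ : G →* ℤˣ := Equiv.Perm.sign.comp (MulAction.toPermHom G E) with hχ₁
  set ψ : G →* ℤˣ := Equiv.Perm.sign.comp (MulAction.toPermHom G P) with hψ
  have hχ₁ρ : χ₁ ρ = -1 := by
    change Equiv.Perm.sign (MulAction.toPerm ρ : Equiv.Perm E) = -1
    exact h.sign_toPerm_rho (by rw [← h.card_pairSpace_eq hπ hπs]; exact hodd)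
  have hψρ : ψ ρ = 1 := by
    change Equiv.Perm.sign (MulAction.toPerm ρ : Equiv.Perm P) = 1
    rw [(toPerm_pairSpace_eq_one_iff hπ hπs hπG ρ).2 fun x => Or.inr rfl, Equiv.Perm.sign_one]
  -- Step A: `ψ(k) = 1 ⟹ χ₁(k) = 1` on `Stab(φ₀)`
  have hA' : ∀ k ∈ MulAction.stabilizer G φ₀, ψ k = 1 → χ₁ k = 1 := fun k hk hs =>
    h.sign_toPerm_eq_one_of_sign_eq_one hπ hπs hπG hV1 hA hk hs
  -- Step B: `χ₁ = 1` or `χ₁ = ψ` on `Stab(φ₀)`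
  by_cases hall : ∀ k ∈ MulAction.stabilizer G φ₀, χ₁ k = 1
  · exact ⟨χ₁, hχ₁ρ, fun k hk => (MonoidHom.mem_ker).2 (hall k hk)⟩
  · push Not at hall
    obtain ⟨k₀, hk₀, hk₀1⟩ := hall
    have hψk₀ : ψ k₀ = -1 := (Int.units_eq_one_or (ψ k₀)).resolve_left fun e => hk₀1 (hA' k₀ hk₀ e)
    have hχk₀ : χ₁ k₀ = -1 := (Int.units_eq_one_or (χ₁ k₀)).resolve_left hk₀1
    refine ⟨χ₁ * ψ, by rw [MonoidHom.mul_apply, hχ₁ρ, hψρ, mul_one], fun k hk => (MonoidHom.mem_ker).2 ?_⟩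
    rw [MonoidHom.mul_apply]
    rcases Int.units_eq_one_or (ψ k) with e | e
    · rw [e, hA' k hk e, one_mul]
    · -- `ψ(k₀⁻¹ k) = 1 ⟹ χ₁(k₀⁻¹ k) = 1 ⟹ χ₁ k = χ₁ k₀ = -1 = ψ k`
      have h1 : ψ (k₀⁻¹ * k) = 1 := by rw [map_mul, map_inv, hψk₀, e]; decide
      have h2 := hA' _ (Subgroup.mul_mem _ (Subgroup.inv_mem _ hk₀) hk) h1
      rw [map_mul, map_inv, hχk₀] at h2
      have h3 : χ₁ k = -1 := by
        rcases Int.units_eq_one_or (χ₁ k) with e' | e'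
        · rw [e'] at h2; exact absurd h2 (by decide)
        · exact e'
      rw [h3, e]; decide

/-! ### `v = 1` ⟹ `n! ∣ |G|` -/

omit [Fintype E] in
open scoped Classical in
/-- **`v = 1` and `Ḡ ⊇ Alt(P)` ⟹ `n! ∣ |G|`**: `|G| = |ker| · |Ḡ| = 2|Ḡ|` and `n!/2 = |Alt(P)|` divides `|Ḡ|`.
[cite: Dodson1987, Prop. 2.1 ("`Gal(K₀ᶜ/ℚ) ≅ Aₙ, or Sₙ`")] -/
theorem factorial_card_pairSpace_dvd_card [Finite G] [Nonempty E] (h : IsCMTypeWith ρ Φ)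
    (hπ : ∀ x y : E, π x = π y ↔ y = x ∨ y = ρ • x) (hπs : Function.Surjective π)
    (hπG : ∀ (g : G) (x : E), π (g • x) = g • π x)
    (hV1 : ∀ g : G, (∀ x : E, g • x = x ∨ g • x = ρ • x) → g = 1 ∨ g = ρ)
    (hA : alternatingGroup P ≤ (MulAction.toPermHom G P).range) :
    (Fintype.card P).factorial ∣ Nat.card G := by
  rcases subsingleton_or_nontrivial P with hP | hP
  · rw [Nat.factorial_eq_one.2 (Fintype.card_le_one_iff_subsingleton.2 hP)]
    exact one_dvd _
  · have hρ1 : ρ ≠ 1 := fun e => by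
      obtain ⟨x⟩ := ‹Nonempty E›
      exact h.rho_smul_ne x (by rw [e, one_smul])
    have hker : Nat.card (MulAction.toPermHom G P).ker = 2 := by
      rw [Nat.card_eq_two_iff]
      refine ⟨⟨1, Subgroup.one_mem _⟩,
        ⟨ρ, (mem_ker_toPermHom_pairSpace_iff hπ hπs hπG ρ).2 fun x => Or.inr rfl⟩,
        fun e => hρ1 (congrArg Subtype.val e).symm, ?_⟩
      rw [Set.eq_univ_iff_forall]
      rintro ⟨k, hk⟩
      have hk' := (mem_ker_toPermHom_pairSpace_iff hπ hπs hπG k).1 hk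
      rcases hV1 k hk' with rfl | rfl
      · exact Set.mem_insert _ _
      · exact Set.mem_insert_of_mem _ (Set.mem_singleton _)
    have hG : Nat.card G = 2 * Nat.card (MulAction.toPermHom G P).range := by
      rw [← Subgroup.card_mul_index (MulAction.toPermHom G P).ker, Subgroup.index_ker, hker]
    have h2A : (Fintype.card P).factorial = 2 * Nat.card (alternatingGroup P) := by
      rw [two_mul_nat_card_alternatingGroup, Nat.card_eq_fintype_card, Fintype.card_perm]
    rw [hG, h2A]
    exact Nat.mul_dvd_mul_left 2 (Subgroup.card_dvd_of_le hA)

/-! ### Dodson 1987, Proposition 2.1 at group level -/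

open scoped Classical in
/-- **Dodson 1987, Proposition 2.1 (group level).**  Let `G` act faithfully and transitively on the `2n`
embeddings `E` of a CM field, `ρ` the complex conjugation, `π : E → P` the `n` pairs `{x, ρx}` (= the embeddings
of the maximal totally real subfield `K₀`).  If `n ≥ 3` is ODD and the image of `G` in `Sym(P)` (= `Gal(K₀ᶜ/ℚ)`)
contains `Alt(P)` ("`Gal(K₀ᶜ/ℚ) ≅ Aₙ, or Sₙ`"), then EVERY PRIMITIVE CM type `Φ` has `Rank(Φ) = n + 1`
(is nondegenerate).  Proof as printed: either the pair kernel has `2ⁿ` elements (one orbit of `2ⁿ` types, rank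
`n + 1` for all of them — `typeRank_eq_of_not_pairKernel_subset`), or it is `{1, ρ}` and then `K ⊇ k` imaginary
quadratic (`exists_monoidHom_stabilizer_le_ker`), over which the `(n−1)/2` orbits of primitive types all have
rank `n + 1` by the Constant Weight Criterion (`typeRank_eq_of_isPrimitive_of_factorial_dvd_of_odd`).
[cite: Dodson1987, Prop. 2.1] -/
theorem typeRank_eq_of_isPrimitive_of_alternatingGroup_le_of_odd [FaithfulSMul G E] [Finite G]
    [MulAction.IsPretransitive G E] (h : IsCMTypeWith ρ Φ)
    (hπ : ∀ x y : E, π x = π y ↔ y = x ∨ y = ρ • x) (hπs : Function.Surjective π)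
    (hπG : ∀ (g : G) (x : E), π (g • x) = g • π x)
    (hA : alternatingGroup P ≤ (MulAction.toPermHom G P).range) (h3 : 3 ≤ Fintype.card P)
    (hodd : Odd (Fintype.card P)) {φh : E} (hP : IsPrimitive G Φ φh) :
    typeRank G Φ = Fintype.card E / 2 + 1 := by
  haveI : Nonempty E := ⟨φh⟩
  have hV := mem_ker_toPermHom_pairSpace_iff (G := G) hπ hπs hπG
  rcases h.pairKernel_subset_or_card_eq_two_pow hπ hπs hπG hV hA h3 hodd with h1 | h1
  · -- `v = 1`: the block over the imaginary quadratic subfield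
    have hV1 : ∀ g : G, (∀ x : E, g • x = x ∨ g • x = ρ • x) → g = 1 ∨ g = ρ :=
      fun g hg => h1 g ((hV g).2 hg)
    obtain ⟨χ, hχρ, hH⟩ := h.exists_monoidHom_stabilizer_le_ker hπ hπs hπG hV1 hA hodd φh
    have h₀ := h.isCMTypeWith_orbit_ker χ hχρ hH
    have hn : (MulAction.orbit χ.ker φh).ncard = Fintype.card P := by
      have := two_mul_ncard_eq_card_of_cm (c := ρ) h₀.mem_iff
      rw [h.card_pairSpace_eq hπ hπs, ← Nat.card_eq_fintype_card]
      omega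
    refine h.typeRank_eq_of_isPrimitive_of_factorial_dvd_of_odd h₀ (smul_orbit_ker_eq_or χ hχρ hH) ?_ ?_ ?_ hP
    · rw [hn]; exact h.factorial_card_pairSpace_dvd_card hπ hπs hπG hV1 hA
    · rwa [hn]
    · rwa [hn]
  · -- `v = n`: a single orbit of `2ⁿ` types
    rw [Nat.card_eq_fintype_card (α := E)] at h1
    exact h.typeRank_eq_of_card_pairKernel_eq hV h1

end Sign


end IsCMTypeWith

end GroupLevel

/-! ## Part II — number fields: the pairs are the embeddings of `K⁺`; Proposition 2.1 as printed -/

section NumberField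

open NumberField IntermediateField
open Literature.AlgebraicGeometry.Motives (CMType)
open Literature.AlgebraicGeometry.Pohlmann1968 (IsNondegenerate)

variable {K : Type} [Field K] [NumberField K] [IsCMField K]
variable {L : Type} [Field L] [NumberField L] [IsCMField L]

/-! ### The pair space `Hom_ℚ(K⁺, L)`: restriction `φ ↦ φ|_{K⁺}` has fibres `{φ, φ̄}`, is onto and equivariant -/

omit [IsCMField K] [IsCMField L] in
/-- `φ|_{K⁺}(k) = φ(k)`. [folklore] -/
private theorem restrictReal_apply (φ : K →ₐ[ℚ] L) (k : maximalRealSubfield K) :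
    ((φ : K →+* L).comp (maximalRealSubfield K).subtype).toRatAlgHom k = φ (k : K) := by
  rw [RingHom.toRatAlgHom_apply]
  rfl

omit [IsCMField K] [IsCMField L] in
/-- Restriction to `K⁺` is `Gal(L/ℚ)`-equivariant. [folklore] -/
private theorem restrictReal_smul (g : L ≃ₐ[ℚ] L) (φ : K →ₐ[ℚ] L) :
    (((g • φ : K →ₐ[ℚ] L) : K →+* L).comp (maximalRealSubfield K).subtype).toRatAlgHom =
      g • ((φ : K →+* L).comp (maximalRealSubfield K).subtype).toRatAlgHom := by
  ext k
  rw [restrictReal_apply, algEquiv_smul_apply, algEquiv_smul_apply, restrictReal_apply]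

/-- **The fibres of `φ ↦ φ|_{K⁺}` are the pairs `{φ, φ̄}`** (`L/ℚ` normal): two embeddings of the CM field `K`
agree on `K⁺` iff they are equal or complex conjugate. [cite: Dodson1984, §1.1 Proposition (proof)] -/
theorem restrict_maximalRealSubfield_eq_iff [Normal ℚ L] (x y : K →ₐ[ℚ] L) :
    ((x : K →+* L).comp (maximalRealSubfield K).subtype).toRatAlgHom =
        ((y : K →+* L).comp (maximalRealSubfield K).subtype).toRatAlgHom ↔
      y = x ∨ y = (conjGal : L ≃ₐ[ℚ] L) • x := by
  obtain ⟨σ, rfl⟩ := exists_algEquiv_smul_eq x y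
  rw [← forall_apply_eq_iff_smul_eq_or σ x]
  constructor
  · intro hxy k hk
    have := AlgHom.congr_fun hxy ⟨k, hk⟩
    rw [restrictReal_apply, restrictReal_apply, algEquiv_smul_apply] at this
    exact this.symm
  · intro hfix
    ext k
    rw [restrictReal_apply, restrictReal_apply, algEquiv_smul_apply]
    exact (hfix k k.2).symm

omit [IsCMField K] [IsCMField L] in
/-- **Every embedding of `K⁺` extends to `K`** (`L/ℚ` normal receiving `K`): restriction is onto `Hom_ℚ(K⁺, L)` —
`G` is transitive on the `n` cosets `S \ G`, `S = Gal(Kᶜ/K₀) ⊇ H = Gal(Kᶜ/K)`, "(G : S) = n".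
[cite: Dodson1984, §1.1 Imprimitivity Theorem (1) (proof)] -/
theorem restrict_maximalRealSubfield_surjective [Normal ℚ L] (j : K →ₐ[ℚ] L) :
    Function.Surjective fun φ : K →ₐ[ℚ] L => ((φ : K →+* L).comp (maximalRealSubfield K).subtype).toRatAlgHom := by
  intro f
  obtain ⟨σ, hσ⟩ := exists_algEquiv_smul_eq (((j : K →+* L).comp (maximalRealSubfield K).subtype).toRatAlgHom) f
  exact ⟨σ • j, (restrictReal_smul σ j).trans hσ⟩

/-- **`Gal(L/K₀ᶜ)` is the kernel of `Gal(L/ℚ) → Sym(Hom_ℚ(K⁺, L))`** (`K₀ᶜ = normalClosure ℚ K⁺ L`): "the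
kernel of the action of `G` on the coset space `S \ G` is the subgroup of `G` fixing all conjugates of `S`".
[cite: Dodson1984, §1.1 Imprimitivity Theorem (2) (proof)] -/
theorem ker_toPermHom_restrict_maximalRealSubfield_eq [Normal ℚ L] (j : K →ₐ[ℚ] L) :
    (MulAction.toPermHom (L ≃ₐ[ℚ] L) (maximalRealSubfield K →ₐ[ℚ] L)).ker =
      (normalClosure ℚ (maximalRealSubfield K) L).fixingSubgroup := by
  ext g
  rw [mem_ker_toPermHom_pairSpace_iff restrict_maximalRealSubfield_eq_iff (restrict_maximalRealSubfield_surjective j)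
    restrictReal_smul g, mem_fixingSubgroup_normalClosure_maximalRealSubfield_iff j]

/-- **`|Gal(K₀ᶜ/ℚ)| = [K₀ᶜ : ℚ]`**: the image of `Gal(L/ℚ)` in `Sym(Hom_ℚ(K⁺, L))` — "`G₀ = Gal(K₀ᶜ/ℚ)` is given
as a transitive permutation group of degree `n` and may be identified with the group of permutations of the sets
of imprimitivity" — has `[K₀ᶜ : ℚ]` elements (`L/ℚ` Galois). [cite: Dodson1984, §1.1 Imprimitivity Theorem (1)] -/
theorem card_range_toPermHom_restrict_maximalRealSubfield [IsGalois ℚ L] (j : K →ₐ[ℚ] L) :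
    Nat.card (MulAction.toPermHom (L ≃ₐ[ℚ] L) (maximalRealSubfield K →ₐ[ℚ] L)).range =
      Module.finrank ℚ (normalClosure ℚ (maximalRealSubfield K) L) := by
  set f := MulAction.toPermHom (L ≃ₐ[ℚ] L) (maximalRealSubfield K →ₐ[ℚ] L)
  set K₀ := normalClosure ℚ (maximalRealSubfield K) L
  have h1 : Nat.card f.ker * f.ker.index = Nat.card (L ≃ₐ[ℚ] L) := Subgroup.card_mul_index f.ker
  rw [Subgroup.index_ker, ker_toPermHom_restrict_maximalRealSubfield_eq j, IsGalois.card_fixingSubgroup_eq_finrank K₀,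
    IsGalois.card_aut_eq_finrank, ← Module.finrank_mul_finrank ℚ K₀ L, mul_comm (Module.finrank ℚ K₀)] at h1
  exact Nat.eq_of_mul_eq_mul_left Module.finrank_pos h1

open scoped Classical in
/-- **`n!/2 ∣ [K₀ᶜ : ℚ]` ⟹ `Gal(K₀ᶜ/ℚ) ⊇ Aₙ`** ("`Gal(K₀ᶜ/ℚ) ≅ Aₙ, or Sₙ`"): a subgroup of `Sₙ` of index `≤ 2`
contains `Aₙ` (Mathlib `Equiv.Perm.alternatingGroup_le_of_index_le_two`). [cite: Dodson1987, Prop. 2.1] -/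
theorem alternatingGroup_le_range_toPermHom_of_factorial_dvd [IsGalois ℚ L] (j : K →ₐ[ℚ] L)
    (hA : (Fintype.card (maximalRealSubfield K →ₐ[ℚ] L)).factorial ∣
      2 * Module.finrank ℚ (normalClosure ℚ (maximalRealSubfield K) L)) :
    alternatingGroup (maximalRealSubfield K →ₐ[ℚ] L) ≤
      (MulAction.toPermHom (L ≃ₐ[ℚ] L) (maximalRealSubfield K →ₐ[ℚ] L)).range := by
  set f := MulAction.toPermHom (L ≃ₐ[ℚ] L) (maximalRealSubfield K →ₐ[ℚ] L)
  have hidx : f.range.index * Nat.card f.range = (Fintype.card (maximalRealSubfield K →ₐ[ℚ] L)).factorial := by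
    rw [mul_comm, Subgroup.card_mul_index, Nat.card_eq_fintype_card, Fintype.card_perm]
  refine Equiv.Perm.alternatingGroup_le_of_index_le_two (Nat.le_of_dvd two_pos ?_)
  rw [← hidx, ← card_range_toPermHom_restrict_maximalRealSubfield j] at hA
  exact Nat.dvd_of_mul_dvd_mul_right Nat.card_pos hA

/-! ### Proposition 2.1 -/

section NormalClosure

variable [IsNormalClosure ℚ K L]

/-- **Dodson 1987, Proposition 2.1.**  "Let `n` be odd and suppose that `K` is a CM-field of degree `2n` such that
the maximal totally real subfield `K₀` has `Gal(K₀ᶜ/ℚ) ≅ Aₙ, or Sₙ`.  Then every primitive CM-type `(K, Φ)` is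
nondegenerate."  Here `L = Kᶜ` is a normal closure of `K`, `K₀ᶜ = normalClosure ℚ K⁺ L`, and the hypothesis on
`Gal(K₀ᶜ/ℚ) ↪ Sₙ` is stated as `n!/2 ∣ [K₀ᶜ : ℚ]` (equivalent: a subgroup of `Sₙ` of index `≤ 2` is `Aₙ` or `Sₙ`);
`n ≥ 3`. [cite: Dodson1987, Prop. 2.1] -/
theorem isNondegenerate_of_isPrimitive_of_factorial_dvd_finrank_normalClosure_of_odd (Φ : CMType K)
    (hA : (Module.finrank ℚ K / 2).factorial ∣ 2 * Module.finrank ℚ (normalClosure ℚ (maximalRealSubfield K) L))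
    (h3 : 6 ≤ Module.finrank ℚ K) (hodd : Odd (Module.finrank ℚ K / 2)) {φ₀ : K →+* ℂ}
    (hP : IsPrimitive (ℂ ≃+* ℂ) Φ.1 φ₀) : IsNondegenerate Φ := by
  classical
  haveI : IsGalois ℚ L := isGalois_of_isNormalClosure K
  obtain ⟨ι⟩ : Nonempty (L →+* ℂ) := inferInstance
  have hcardE : Fintype.card (K →ₐ[ℚ] L) = Module.finrank ℚ K := card_algHom_eq_finrank K
  obtain ⟨j⟩ : Nonempty (K →ₐ[ℚ] L) := Fintype.card_pos_iff.1 (by rw [hcardE]; exact Module.finrank_pos)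
  have h := isCMTypeWith_conjGal_algValuedIn ι Φ
  have hπ := restrict_maximalRealSubfield_eq_iff (K := K) (L := L)
  have hπs := restrict_maximalRealSubfield_surjective j
  have hπG : ∀ (g : L ≃ₐ[ℚ] L) (φ : K →ₐ[ℚ] L),
      (((g • φ : K →ₐ[ℚ] L) : K →+* L).comp (maximalRealSubfield K).subtype).toRatAlgHom =
        g • ((φ : K →+* L).comp (maximalRealSubfield K).subtype).toRatAlgHom := restrictReal_smul
  have hcardP : Fintype.card (maximalRealSubfield K →ₐ[ℚ] L) = Module.finrank ℚ K / 2 := by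
    rw [h.card_pairSpace_eq hπ hπs, hcardE]
  rw [isNondegenerate_iff_typeRank_algValuedIn j ι Φ]
  exact h.typeRank_eq_of_isPrimitive_of_alternatingGroup_le_of_odd hπ hπs hπG
    (alternatingGroup_le_range_toPermHom_of_factorial_dvd j (by rwa [hcardP])) (by rw [hcardP]; omega)
    (by rwa [hcardP]) ((isPrimitive_algValuedIn_iff j ι Φ.1 j φ₀).2 hP)

/-! ### The dichotomy on the number field: `[Kᶜ : K₀ᶜ] ∈ {2, 2ⁿ}`; `[Kᶜ : K₀ᶜ] = 2` ⟹ `K ⊇ k` imaginary quadratic -/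

/-- **"Either there is a single `Gal(Kᶜ/ℚ)`-orbit of types of order `2ⁿ` … or else `K` contains an imaginary
quadratic subfield"**, first half, on the field: for `K` CM of degree `2n`, `n ≥ 3` odd, `Gal(K₀ᶜ/ℚ) ≅ Aₙ` or `Sₙ`
(`n!/2 ∣ [K₀ᶜ : ℚ]`), the degree `[Kᶜ : K₀ᶜ] = 2ᵛ` is `2` or `2ⁿ`. [cite: Dodson1987, Prop. 2.1 (proof)] -/
theorem finrank_normalClosure_maximalRealSubfield_eq_two_or_eq_two_pow
    (hA : (Module.finrank ℚ K / 2).factorial ∣ 2 * Module.finrank ℚ (normalClosure ℚ (maximalRealSubfield K) L))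
    (h3 : 6 ≤ Module.finrank ℚ K) (hodd : Odd (Module.finrank ℚ K / 2)) :
    Module.finrank (normalClosure ℚ (maximalRealSubfield K) L) L = 2 ∨
      Module.finrank (normalClosure ℚ (maximalRealSubfield K) L) L = 2 ^ (Module.finrank ℚ K / 2) := by
  classical
  haveI : IsGalois ℚ L := isGalois_of_isNormalClosure K
  obtain ⟨ι⟩ : Nonempty (L →+* ℂ) := inferInstance
  have hcardE : Fintype.card (K →ₐ[ℚ] L) = Module.finrank ℚ K := card_algHom_eq_finrank K
  obtain ⟨j⟩ : Nonempty (K →ₐ[ℚ] L) := Fintype.card_pos_iff.1 (by rw [hcardE]; exact Module.finrank_pos)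
  have h := isCMTypeWith_conjGal_algValuedIn ι (CMTypeCount.stdCMType (K := K))
  have hπ := restrict_maximalRealSubfield_eq_iff (K := K) (L := L)
  have hπs := restrict_maximalRealSubfield_surjective j
  have hπG : ∀ (g : L ≃ₐ[ℚ] L) (φ : K →ₐ[ℚ] L),
      (((g • φ : K →ₐ[ℚ] L) : K →+* L).comp (maximalRealSubfield K).subtype).toRatAlgHom =
        g • ((φ : K →+* L).comp (maximalRealSubfield K).subtype).toRatAlgHom := restrictReal_smul
  have hcardP : Fintype.card (maximalRealSubfield K →ₐ[ℚ] L) = Module.finrank ℚ K / 2 := by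
    rw [h.card_pairSpace_eq hπ hπs, hcardE]
  have hV := mem_fixingSubgroup_normalClosure_maximalRealSubfield_iff (K := K) (L := L) j
  rw [← IsGalois.card_fixingSubgroup_eq_finrank]
  rcases h.pairKernel_subset_or_card_eq_two_pow hπ hπs hπG hV
      (alternatingGroup_le_range_toPermHom_of_factorial_dvd j (by rwa [hcardP])) (by rw [hcardP]; omega)
      (by rwa [hcardP]) with h1 | h1
  · left
    rw [Nat.card_eq_two_iff]
    refine ⟨⟨1, Subgroup.one_mem _⟩,
      ⟨conjGal, conjGal_mem_fixingSubgroup_normalClosure_maximalRealSubfield j⟩, fun e => ?_, ?_⟩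
    · have e' : (1 : L ≃ₐ[ℚ] L) = conjGal := congrArg Subtype.val e
      exact h.rho_smul_ne j (by rw [← e', one_smul])
    · rw [Set.eq_univ_iff_forall]
      rintro ⟨g, hg⟩
      rcases h1 g hg with rfl | rfl
      · exact Set.mem_insert _ _
      · exact Set.mem_insert_of_mem _ (Set.mem_singleton _)
  · right
    rw [h1, Nat.card_eq_fintype_card, hcardE]

/-- **… second half: `[Kᶜ : K₀ᶜ] = 2` ⟹ `K` contains an imaginary quadratic field** (same hypotheses): there is
`k ⊆ j(K) ⊆ L = Kᶜ` with `[k : ℚ] = 2` on which complex conjugation is non-trivial — `k = (Kᶜ)^{ker χ}` for the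
character `χ` of `IsCMTypeWith.exists_monoidHom_stabilizer_le_ker`. [cite: Dodson1987, Prop. 2.1 (proof)] -/
theorem exists_intermediateField_le_fieldRange_of_finrank_normalClosure_eq_two (j : K →ₐ[ℚ] L)
    (hA : (Module.finrank ℚ K / 2).factorial ∣ 2 * Module.finrank ℚ (normalClosure ℚ (maximalRealSubfield K) L))
    (hodd : Odd (Module.finrank ℚ K / 2))
    (hv : Module.finrank (normalClosure ℚ (maximalRealSubfield K) L) L = 2) :
    ∃ k : IntermediateField ℚ L, k ≤ j.fieldRange ∧ Module.finrank ℚ k = 2 ∧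
      ∃ y ∈ k, IsCMField.complexConj L y ≠ y := by
  classical
  haveI : IsGalois ℚ L := isGalois_of_isNormalClosure K
  obtain ⟨ι⟩ : Nonempty (L →+* ℂ) := inferInstance
  have hcardE : Fintype.card (K →ₐ[ℚ] L) = Module.finrank ℚ K := card_algHom_eq_finrank K
  have h := isCMTypeWith_conjGal_algValuedIn ι (CMTypeCount.stdCMType (K := K))
  have hπ := restrict_maximalRealSubfield_eq_iff (K := K) (L := L)
  have hπs := restrict_maximalRealSubfield_surjective j
  have hπG : ∀ (g : L ≃ₐ[ℚ] L) (φ : K →ₐ[ℚ] L),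
      (((g • φ : K →ₐ[ℚ] L) : K →+* L).comp (maximalRealSubfield K).subtype).toRatAlgHom =
        g • ((φ : K →+* L).comp (maximalRealSubfield K).subtype).toRatAlgHom := restrictReal_smul
  have hcardP : Fintype.card (maximalRealSubfield K →ₐ[ℚ] L) = Module.finrank ℚ K / 2 := by
    rw [h.card_pairSpace_eq hπ hπs, hcardE]
  have hV := mem_fixingSubgroup_normalClosure_maximalRealSubfield_iff (K := K) (L := L) j
  have hρ1 : (conjGal : L ≃ₐ[ℚ] L) ≠ 1 := fun e => h.rho_smul_ne j (by rw [e, one_smul])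
  -- `v = 1`: the pair kernel is `{1, ρ}`
  have hV2 : Nat.card (normalClosure ℚ (maximalRealSubfield K) L).fixingSubgroup = 2 := by
    rw [IsGalois.card_fixingSubgroup_eq_finrank, hv]
  rw [Nat.card_eq_two_iff' (⟨1, Subgroup.one_mem _⟩ : (normalClosure ℚ (maximalRealSubfield K) L).fixingSubgroup)]
    at hV2
  obtain ⟨y, -, huniq⟩ := hV2
  have hV1 : ∀ g : L ≃ₐ[ℚ] L, (∀ x : K →ₐ[ℚ] L, g • x = x ∨ g • x = (conjGal : L ≃ₐ[ℚ] L) • x) →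
      g = 1 ∨ g = conjGal := by
    intro g hg
    by_cases hg1 : g = 1
    · exact Or.inl hg1
    · right
      have e1 := huniq ⟨g, (hV g).2 hg⟩ fun e => hg1 (congrArg Subtype.val e)
      have e2 := huniq ⟨conjGal, conjGal_mem_fixingSubgroup_normalClosure_maximalRealSubfield j⟩ fun e =>
        hρ1 (congrArg Subtype.val e)
      exact congrArg Subtype.val (e1.trans e2.symm)
  obtain ⟨χ, hχρ, hH⟩ := h.exists_monoidHom_stabilizer_le_ker hπ hπs hπG hV1
    (alternatingGroup_le_range_toPermHom_of_factorial_dvd j (by rwa [hcardP])) (by rwa [hcardP]) j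
  refine ⟨IntermediateField.fixedField χ.ker, ?_, ?_, ?_⟩
  · rw [← fixedField_stabilizer_algHom j]
    exact IntermediateField.fixedField_le hH
  · -- `[k : ℚ] = (G : ker χ) = 2`
    have hidx : χ.ker.index = 2 := by
      rw [Subgroup.index_eq_two_iff]
      refine ⟨conjGal, fun b => ?_⟩
      rw [MonoidHom.mem_ker, MonoidHom.mem_ker, map_mul, hχρ]
      rcases Int.units_eq_one_or (χ b) with e | e <;> rw [e] <;> decide
    have h1 := Subgroup.card_mul_index χ.ker
    have h2 := Module.finrank_mul_finrank ℚ (IntermediateField.fixedField χ.ker) L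
    rw [IntermediateField.finrank_fixedField_eq_card, ← IsGalois.card_aut_eq_finrank (F := ℚ) (E := L), ← h1, hidx,
      mul_comm (Nat.card χ.ker) 2] at h2
    exact Nat.eq_of_mul_eq_mul_right Nat.card_pos h2
  · -- complex conjugation does not fix `k`
    by_contra hall
    push Not at hall
    have hmem : (conjGal : L ≃ₐ[ℚ] L) ∈ (IntermediateField.fixedField χ.ker).fixingSubgroup := by
      rw [IntermediateField.mem_fixingSubgroup_iff]
      intro z hz
      exact hall z hz
    rw [IntermediateField.fixingSubgroup_fixedField, MonoidHom.mem_ker, hχρ] at hmem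
    exact absurd hmem (by decide)

/-- **The printed dichotomy, assembled**: for `K` CM of degree `2n`, `n ≥ 3` odd, with `Gal(K₀ᶜ/ℚ) ≅ Aₙ` or `Sₙ`,
EITHER every CM type of `K` is nondegenerate ("a single `Gal(Kᶜ/ℚ)`-orbit of types of order `2ⁿ`, in which case
`Rank(Φ) = n + 1` is clear" — the tree's `isNondegenerate_of_finrank_normalClosure_eq`), OR `K` contains an imaginary
quadratic field. [cite: Dodson1987, Prop. 2.1 (proof)] -/
theorem forall_isNondegenerate_or_exists_intermediateField_le_fieldRange (j : K →ₐ[ℚ] L)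
    (hA : (Module.finrank ℚ K / 2).factorial ∣ 2 * Module.finrank ℚ (normalClosure ℚ (maximalRealSubfield K) L))
    (h3 : 6 ≤ Module.finrank ℚ K) (hodd : Odd (Module.finrank ℚ K / 2)) :
    (∀ Φ : CMType K, IsNondegenerate Φ) ∨
      ∃ k : IntermediateField ℚ L, k ≤ j.fieldRange ∧ Module.finrank ℚ k = 2 ∧
        ∃ y ∈ k, IsCMField.complexConj L y ≠ y := by
  rcases finrank_normalClosure_maximalRealSubfield_eq_two_or_eq_two_pow (K := K) (L := L) hA h3 hodd with hv | hv
  · exact Or.inr (exists_intermediateField_le_fieldRange_of_finrank_normalClosure_eq_two j hA hodd hv)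
  · obtain ⟨ι⟩ : Nonempty (L →+* ℂ) := inferInstance
    exact Or.inl fun Φ => isNondegenerate_of_finrank_normalClosure_eq j hv ι Φ

end NormalClosure

end NumberField


end Literature.NumberTheory.ComplexMultiplication
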